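import Summits.AtomisticToContinuum.BoseEinsteinCondensation.Theses.BECCutLineWeakDisorder

/-!
# Route BECCutLineWeakDisorder — `ZeroModeOfLandscape` (glue item stmt-AtomisticToContinuum-9089)

The pure-bookkeeping glue of the route:
`LandscapeBound → GroundStateRigidity → FlatModeFromLandscape → OccupationStability → X_B1`,
where X_B1 is the zero-mode thesis (the flat mode `φ₀ = L^{-3/2}·1_{Λ_L}` has occupation `≥ c N`
in every `δ`-near-minimiser, for all large `N`, at every small density).

Proof (as planned by the route): fix `v`; `ρ₀ = min` of the two thresholds; for `ρ < ρ₀` take `C`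
from `LandscapeBound` and put `c = 1/(4C)`; write `N = n + 1` for large `N`; apply
`GroundStateRigidity` with `η = 1/(4C)` to get `δ`; the nonnegative witness `Ψ` of `LandscapeBound`
at this `δ` has `occ(φ₀, Ψ) ≥ N/C` by `FlatModeFromLandscape`; any `δ`-near-minimiser `Φ` is
`√η`-close to `Ψ` up to a phase, so `OccupationStability` gives
`occ(φ₀, Φ)^{1/2} ≥ (N/C)^{1/2} - (N/(4C))^{1/2} = ½ (N/C)^{1/2}`, i.e. `occ(φ₀, Φ) ≥ N/(4C)`.
-/

noncomputable section

namespace Summit.AtomisticToContinuum.BoseEinsteinCondensation.Theorems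

open MeasureTheory ENNReal Filter Literature.MathematicalPhysics.QuantumManyBody.BoseGas

/-- The `√`-bookkeeping of the glue in `ℝ≥0∞`: from `N ≤ P·K` (flat-mode bound for the witness,
`P = occ(φ₀,Ψ)`, `K = C`), `P^{1/2} ≤ A^{1/2} + N^{1/2} E^{1/2}` (occupation stability,
`A = occ(φ₀,Φ)`, `E = ‖Ψ - cΦ‖₂²`) and `E ≤ (4K)⁻¹` (rigidity) we get `N/(4K) ≤ A`. [folklore] -/
theorem zeroMode_sqrt_bookkeeping {N P A E K : ℝ≥0∞} (hK0 : K ≠ 0) (hN : N ≠ ⊤)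
    (h1 : N ≤ P * K)
    (h2 : P ^ (1 / 2 : ℝ) ≤ A ^ (1 / 2 : ℝ) + N ^ (1 / 2 : ℝ) * E ^ (1 / 2 : ℝ))
    (hE : E ≤ (4 * K)⁻¹) : N / (4 * K) ≤ A := by
  have h4 : (4 : ℝ≥0∞) ≠ 0 := by norm_num
  have h4t : (4 : ℝ≥0∞) ≠ ⊤ := ENNReal.ofNat_ne_top
  have h4K0 : 4 * K ≠ 0 := mul_ne_zero h4 hK0
  have ht : N / (4 * K) ≠ ⊤ := ENNReal.div_ne_top hN h4K0
  have hs : (N / (4 * K)) ^ (1 / 2 : ℝ) ≠ ⊤ := ENNReal.rpow_ne_top_of_nonneg (by norm_num) ht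
  have hsqrt4 : (4 : ℝ≥0∞) ^ (1 / 2 : ℝ) = 2 := by
    have h42 : (4 : ℝ≥0∞) = 2 ^ (2 : ℝ) := by rw [ENNReal.rpow_two]; norm_num
    rw [h42, ← ENNReal.rpow_mul]
    norm_num
  have hP : 4 * (N / (4 * K)) ≤ P := by
    rw [← mul_div_assoc, ENNReal.mul_div_mul_left _ _ h4 h4t]
    exact ENNReal.div_le_of_le_mul h1
  have hchain : 2 * (N / (4 * K)) ^ (1 / 2 : ℝ) ≤ A ^ (1 / 2 : ℝ) + (N / (4 * K)) ^ (1 / 2 : ℝ) :=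
    calc 2 * (N / (4 * K)) ^ (1 / 2 : ℝ) = (4 * (N / (4 * K))) ^ (1 / 2 : ℝ) := by
          rw [ENNReal.mul_rpow_of_nonneg _ _ (by norm_num : (0 : ℝ) ≤ 1 / 2), hsqrt4]
      _ ≤ P ^ (1 / 2 : ℝ) := ENNReal.rpow_le_rpow hP (by norm_num)
      _ ≤ A ^ (1 / 2 : ℝ) + N ^ (1 / 2 : ℝ) * E ^ (1 / 2 : ℝ) := h2
      _ ≤ A ^ (1 / 2 : ℝ) + N ^ (1 / 2 : ℝ) * ((4 * K)⁻¹) ^ (1 / 2 : ℝ) :=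
          add_le_add_right (mul_le_mul_right (ENNReal.rpow_le_rpow hE (by norm_num : (0 : ℝ) ≤ 1 / 2)) _) _
      _ = A ^ (1 / 2 : ℝ) + (N / (4 * K)) ^ (1 / 2 : ℝ) := by
          rw [← ENNReal.mul_rpow_of_nonneg _ _ (by norm_num : (0 : ℝ) ≤ 1 / 2), ← div_eq_mul_inv]
  have hs_le : (N / (4 * K)) ^ (1 / 2 : ℝ) ≤ A ^ (1 / 2 : ℝ) := by
    rw [two_mul] at hchain
    exact (ENNReal.add_le_add_iff_right hs).mp hchain
  exact (ENNReal.rpow_le_rpow_iff (by norm_num : (0 : ℝ) < 1 / 2)).mp hs_le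

/-- Settles `stmt-AtomisticToContinuum-9089` (exact signature): the glue
`LandscapeBound → GroundStateRigidity → FlatModeFromLandscape → OccupationStability → X_B1` of route
`BECCutLineWeakDisorder`, with `ρ₀ = min`, `c = 1/(4C)`, `η = 1/(4C)` (Lieb–Seiringer–Solovej–Yngvason
2005 §1.2 for the objects; the argument is elementary bookkeeping). [folklore] -/
theorem zeroModeOfLandscape_proof :
    Summit.AtomisticToContinuum.BoseEinsteinCondensation.Theses.BECCutLineWeakDisorder.ZeroModeOfLandscape := by
  unfold Summit.AtomisticToContinuum.BoseEinsteinCondensation.Theses.BECCutLineWeakDisorder.ZeroModeOfLandscape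
  intro hLand hRig hFlat hOcc v hv
  obtain ⟨ρ₁, hρ₁, H₁⟩ := hLand v hv
  obtain ⟨ρ₂, hρ₂, H₂⟩ := hRig v hv
  refine ⟨min ρ₁ ρ₂, lt_min hρ₁ hρ₂, fun ρ hρ hρlt => ?_⟩
  obtain ⟨C, hC, hevL⟩ := H₁ ρ hρ (hρlt.trans_le (min_le_left _ _))
  have hevR := H₂ ρ hρ (hρlt.trans_le (min_le_right _ _))
  refine ⟨1 / (4 * C), by positivity, ?_⟩
  obtain ⟨n₀, hn₀⟩ :=
    Filter.eventually_atTop.mp (hevL.and ((Filter.tendsto_add_atTop_nat 1).eventually hevR))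
  refine Filter.eventually_atTop.mpr ⟨n₀ + 1, fun N hN => ?_⟩
  obtain ⟨n, rfl⟩ : ∃ n, N = n + 1 := ⟨N - 1, by omega⟩
  obtain ⟨hLn, hRn⟩ := hn₀ n (by omega)
  obtain ⟨δ, hδ, hrig⟩ := hRn (1 / (4 * C)) (by positivity)
  obtain ⟨Ψ, hΨE, hΨnn, hΨland⟩ := hLn δ hδ
  refine ⟨δ, hδ, fun Φ hΦE => ?_⟩
  obtain ⟨c, hc, hclose⟩ := hrig Ψ Φ hΨE hΦE
  have hLpos : 0 < sideLength ρ (n + 1) := by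
    unfold sideLength
    exact Real.rpow_pos_of_pos (div_pos (Nat.cast_pos.mpr (Nat.succ_pos n)) hρ) _
  have hflat := hFlat n (sideLength ρ (n + 1)) hLpos Ψ hΨnn
  have hstab := hOcc n (sideLength ρ (n + 1)) _
    (_root_.AtomisticToContinuum.BECInfraredBound.aestronglyMeasurable_constMode _)
    (_root_.AtomisticToContinuum.BECInfraredBound.lintegral_constMode_sq hLpos) Ψ Φ c hc
  have hK0 : ENNReal.ofReal C ≠ 0 := (ENNReal.ofReal_pos.mpr hC).ne'
  have hE : ∫⁻ X, (‖Ψ.ψ X - c * Φ.ψ X‖₊ : ℝ≥0∞) ^ 2 ≤ (4 * ENNReal.ofReal C)⁻¹ := by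
    refine hclose.trans (le_of_eq ?_)
    rw [one_div, ENNReal.ofReal_inv_of_pos (by positivity), ENNReal.ofReal_mul (by norm_num),
      ENNReal.ofReal_ofNat]
  have key := zeroMode_sqrt_bookkeeping hK0 (ENNReal.natCast_ne_top (n + 1))
    (hflat.trans (mul_le_mul_right hΨland _)) hstab hE
  calc ENNReal.ofReal (1 / (4 * C) * ((n + 1 : ℕ) : ℝ))
      = ((n + 1 : ℕ) : ℝ≥0∞) / (4 * ENNReal.ofReal C) := by
        rw [ENNReal.ofReal_mul (by positivity), ENNReal.ofReal_natCast, one_div,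
          ENNReal.ofReal_inv_of_pos (by positivity), ENNReal.ofReal_mul (by norm_num),
          ENNReal.ofReal_ofNat, ENNReal.div_eq_inv_mul]
    _ ≤ _ := key

end Summit.AtomisticToContinuum.BoseEinsteinCondensation.Theorems

end
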